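import Mathlib
import Literature.MathematicalPhysics.QuantumFieldTheory.Balaban1983to89.B5Momentum133

/-!
# B5 pp. 29–30: the position-space operator `Δ_a` of (1.69)/(1.73) IS the operator `𝒟_a` of
# passes 4–6 (Fourier blocks (1.73)/(1.83)) — «G = Δ_a⁻¹» (1.71) for the lattice operator itself

Source: T. Bałaban, *Propagators and renormalization transformations for lattice gauge
theories. I*, Commun. Math. Phys. 95 (1984) 17–40 (`Balaban1984PropagatorsI`, "B5"), renders
`b2b-balaban-ref1/pages/1984-cmp95-propagators-rt-I/…-p005-x2.png` (journal p. 21),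
`…-p013-x2.png` (p. 29), `…-p014-x2.png` (p. 30), read as images this session.

## What the paper prints (verbatim)

p. 29, Sect. E «Operators G»: «The quadratic form in the fields A in the exponential is equal to
  ⟨A, Δ_a A⟩ = ⟨A, ∂*∂A⟩ + ⟨A, ∂R∂*A⟩ + a⟨A, Q*QA⟩
             = ⟨A, ΔA⟩ − ⟨A, ∂P∂*A⟩ + a⟨A, Q*QA⟩,   (1.69)
  Δ = ∂*∂ + ∂∂*, R = I − P,»
p. 30: «where we have omitted subscripts. The configuration ∂*A is orthogonal to constant
functions and on such configurations the operator P is given by the formula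
  P = Δ⁻¹Q′*(Q′Δ⁻²Q′*)⁻¹Q′Δ⁻¹.   (1.70)
We will obtain an explicit representation of
  Δ_a⁻¹ = G_k, or simply G.   (1.71)
At first let us prove that Δ_a is a positive operator. Of course it is a symmetric operator and
it is non-negative as a sum of two non-negative operators Δ − ∂P∂* and aQ*Q, a > 0.» … «so A = 0
and the positivity of Δ_a follows. It is an invertible operator and the equation
  ΔA − ∂Δ⁻¹Q′*(Q′Δ⁻²Q′*)⁻¹Q′Δ⁻¹∂*A + aQ*QA = J   (1.73)
has a unique solution for the arbitrary vector function J. We consider A also as a vector valued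
function on the lattice T_η.» … «For each component A_μ we have from (1.73)
  a⟨1, Q*QA_μ⟩ = a⟨1, A_μ⟩ = ⟨1, J_μ⟩,   (1.74)
so ⟨1, A_μ⟩ = a⁻¹⟨1, J_μ⟩, 1 denotes here a function on T_η identically equal to 1.»
p. 21, (1.21) (the scalar products on `T_η` carry the weight `η^d`):
«⟨∂A, ∂A⟩ = ½ Σ_{x∈T_η,μ,ν} η^d|F_{μν}(x)|² = … = Σ_μ ⟨A_μ, ΔA_μ⟩ − ⟨∂*A, ∂*A⟩,   (1.21)
where Δ is η-lattice Laplace operator for scalar functions and ∂* is the divergence operator for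
vector functions, ∂*A = Σ_μ ∂*_μ A_μ.»

## What this module types, and certifies in the kernel

Passes 4–6 (`B5Prop11Plancherel`, `B5Prop11Inverse`, `B5Prop11Lower`) built the operator
`𝒟_a = calDa` on `ℓ²(T_η; ℂ^d)` FROM ITS FOURIER BLOCKS — the fiber matrices `Da`/`Da₀` of (1.73)
over the cosets `p = p′ + l` — proved `𝒢 = 𝒟_a⁻¹` with `𝒢 = calG` the operator with blocks (1.83),
the six bounds (1.89) for `𝒢` and (1.90) for `𝒟_a`; pass 5 recorded as NOT certified «that calDa IS
the lattice operator Δ − ∂P∂* + aQ*Q».  This module closes that gap.  With the position-space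
operators already typed from the printed definitions —
* `∂ = GradOp (fine n M) n` ((1.4), `B5Action121`), `∂* = (GradOp …)ᴴ = divS` ((1.21),
  `B5Action121.GradOp_conjTranspose_mulVec_eq`),
* `Δ = B5Prop11Lower.Lap n M = Σ_ν ∇_ν^*∇_ν` componentwise, which is «Δ = ∂*∂ + ∂∂*» on vector
  functions by (1.21) (`B5Action121.curl_adjoint_curl`, `Lap_eq_LapV`),
* `P = B5Value126.PcT n M n = Δ⁻¹Q′*_k(Q′_kΔ⁻²Q′*_k)⁻¹Q′_kΔ⁻¹` ((1.26) = (1.70)),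
* `Q_k = B5Block118.QvOp n M` ((1.18)) and its adjoint `Q*_k = QvAdj n M := n^d • (QvOp n M)ᴴ`
  (DICTIONARY: B5's `Q*` is the adjoint of `Q_k : L²(T_η) → L²(T₁^{(k)})` for the `η^d`-weighted
  scalar product (1.21) on `T_η`, `η = 1/n`, and the unit weight on the unit lattice; on matrices
  this is `η^{-d}·(conjugate transpose)`.  The factor is CERTIFIED, not chosen: `sum_QvAdj_QvOp`
  proves (1.74) «⟨1, Q*QA_μ⟩ = ⟨1, A_μ⟩» for `QvAdj`, and no other scalar multiple of `(QvOp)ᴴ`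
  satisfies it; `QvAdj_adjoint` is the adjointness identity) —
we DEFINE `DeltaA n M a := Lap − ∂·P·∂ᴴ + a•(Q*_kQ_k)`, literally «Δ − ∂P∂* + aQ*Q» (1.69)/(1.73),
`η = 1/n`, coarse torus `Tor M`, fine torus `T_η = Tor (fine n M)`, and PROVE
* `DeltaA_eq_curl`: the first form of (1.69), `Δ_a = ∂*∂ + ∂R∂* + aQ*Q`, `R = I − P`, with
  `∂*∂ = ½(CurlOp)ᴴCurlOp` (ordered pairs `(μ,ν)`, the `½` of (1.21); pass 7);
* `calDa_eq_DeltaA` (MAIN): `B5Prop11Inverse.calDa n hn M a ha = DeltaA n M a` — fiber by fiber: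
  at `p′ ≠ 0` the three terms of `Δ_a` have the blocks `lapV`, `dOp·Pproj·dOpᴴ`, `a•QvᴴQv` of pass
  5's `Da (fiberAt q)` (`B5FiberDelta.dft_Lap_fiber`, the symbols (1.31) of `∂`, `∂*` with
  `B5Momentum133.fiber_PcT`, `B5FiberQQ.fiber_QstarQ`), at `p′ = 0` the blocks of `Da₀`
  (`B5FiberDelta.dft_Lap`, `B5Momentum133.dft_PcT_zero_fiber`: the `∂P∂*` term has no `p′ = 0`
  component, `B5FiberZero.dft_QstarQ_zero_fiber`);
* hence, for the POSITION-SPACE `Δ_a`: `DeltaA * calG = 1 = calG * DeltaA`, `calG = DeltaA⁻¹`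
  («Δ_a⁻¹ = G» (1.71), `𝒢` = the operator with Fourier blocks (1.83)), `DeltaA` Hermitian and
  positive definite («Δ_a is a positive operator … It is an invertible operator»), (1.73) «has a
  unique solution for the arbitrary vector function J» (`existsUnique_solution`), (1.90)
  `γ(Δ + I) ≤ Δ_a` and the bounds (1.89) `‖Δ_a⁻¹‖, ‖∇_νΔ_a⁻¹‖, ‖Δ_a⁻¹∇_ν^*‖, ‖∇_νΔ_a⁻¹∇_{ν′}^*‖
  ≤ Cst(d,a)` (kernel versions of passes 4/6, constants ours, now stated for the lattice operator).

NOT claimed: the Gaussian-integral identities (1.64)–(1.68) leading to (1.69) (integrals are out of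
scope of this cell); the concrete B5 sizes `n = L^k`, `M_μ = 2L_μ/(L^kε)` (any `n ≥ 1`, `M_μ ≥ 1`
here). value = kernel certificate that the typed Sect. C/E operator of passes 4–6 is the printed
position-space `Δ_a`, NOT summit progress.
-/

open scoped BigOperators Matrix ComplexConjugate ComplexOrder Matrix.Norms.L2Operator
open Finset Complex Matrix

namespace Literature.MathematicalPhysics.QuantumFieldTheory.Balaban1983to89.B5DeltaA169

open Literature.MathematicalPhysics.QuantumFieldTheory.Balaban1983to89.B4Strip
open Literature.MathematicalPhysics.QuantumFieldTheory.Balaban1983to89.B5Prop11Fiber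
open Literature.MathematicalPhysics.QuantumFieldTheory.Balaban1983to89.B5Prop11Bound
open Literature.MathematicalPhysics.QuantumFieldTheory.Balaban1983to89.B5Prop11Plancherel
open Literature.MathematicalPhysics.QuantumFieldTheory.Balaban1983to89.B5Prop11Inverse
open Literature.MathematicalPhysics.QuantumFieldTheory.Balaban1983to89.B5Prop11Lower
open Literature.MathematicalPhysics.QuantumFieldTheory.Balaban1983to89.B5Action121
open Literature.MathematicalPhysics.QuantumFieldTheory.Balaban1983to89.B5Block118
open Literature.MathematicalPhysics.QuantumFieldTheory.Balaban1983to89.B5Adjoint176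
open Literature.MathematicalPhysics.QuantumFieldTheory.Balaban1983to89.B5FiberQQ
open Literature.MathematicalPhysics.QuantumFieldTheory.Balaban1983to89.B5FiberDelta
open Literature.MathematicalPhysics.QuantumFieldTheory.Balaban1983to89.B5FiberZero
open Literature.MathematicalPhysics.QuantumFieldTheory.Balaban1983to89.B5LaplaceInverse
open Literature.MathematicalPhysics.QuantumFieldTheory.Balaban1983to89.B5Value126
open Literature.MathematicalPhysics.QuantumFieldTheory.Balaban1983to89.B5Momentum130
open Literature.MathematicalPhysics.QuantumFieldTheory.Balaban1983to89.B5Momentum133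

noncomputable section

/-! ## §1 Fourier tools: the componentwise DFT and the symbols (1.31) of `∂`, `∂*` -/

section Tools

variable {d : ℕ} (N : Fin d → ℕ) [hN : ∀ μ, NeZero (N μ)]

/-- `(U A)(p, κ) = (U A_κ)(p)`: the componentwise DFT transforms component by component.
[folklore] -/
theorem dftV_mulVec_apply (A : Tor N × Fin d → ℂ) (p : Tor N) (κ : Fin d) :
    (dftV N *ᵥ A) (p, κ) = (dft N *ᵥ B5Action121.comp N A κ) p := by
  simp only [Matrix.mulVec, dotProduct, Fintype.sum_prod_type, dftV_apply, B5Action121.comp,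
    ite_mul, zero_mul, Finset.sum_ite_eq, Finset.mem_univ, if_true]

/-- `U ∂_ν^* = diag(\overline{∂_ν(p)}) U`. [folklore] -/
theorem dft_mul_sdiffH (c : ℂ) (ν : Fin d) :
    dft N * (sdiff N c ν)ᴴ = Matrix.diagonal (star (ssym N c ν)) * dft N := by
  have h := dft_mul_sdiff N c ν
  have hU1 := dft_mul_conjTranspose N
  have hU2 := dft_conjTranspose_mul N
  have hH : (sdiff N c ν)ᴴ = (dft N)ᴴ * (Matrix.diagonal (ssym N c ν))ᴴ * dft N := by
    have h2 := congrArg Matrix.conjTranspose h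
    rw [Matrix.conjTranspose_mul, Matrix.conjTranspose_mul] at h2
    calc (sdiff N c ν)ᴴ = (sdiff N c ν)ᴴ * ((dft N)ᴴ * dft N) := by rw [hU2, Matrix.mul_one]
      _ = (dft N)ᴴ * (Matrix.diagonal (ssym N c ν))ᴴ * dft N := by rw [← Matrix.mul_assoc, h2]
  rw [hH, ← Matrix.mul_assoc, ← Matrix.mul_assoc, hU1, Matrix.one_mul,
    Matrix.diagonal_conjTranspose]

/-- the symbol of the gradient: `(∂f)^_κ(p) = ∂_κ(p) f̃(p)`, `∂_κ(p) = c(e^{ip_κ} − 1)` ((1.31)).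
[cite: Balaban1984PropagatorsI, (1.31) p.23] -/
theorem dft_comp_GradOp (c : ℂ) (f : Tor N → ℂ) (κ : Fin d) (p : Tor N) :
    (dft N *ᵥ B5Action121.comp N (GradOp N c *ᵥ f) κ) p = ssym N c κ p * (dft N *ᵥ f) p := by
  have h : B5Action121.comp N (GradOp N c *ᵥ f) κ = sdiff N c κ *ᵥ f := rfl
  rw [h, Matrix.mulVec_mulVec, dft_mul_sdiff, ← Matrix.mulVec_mulVec, Matrix.mulVec_diagonal]

/-- the symbol of the divergence `∂* = (∂)^*`: `(∂*A)~(p) = Σ_ν \overline{∂_ν(p)} Â_ν(p)` ((1.21),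
(1.31)). [cite: Balaban1984PropagatorsI, (1.21) p.21, (1.31) p.23] -/
theorem dft_GradOp_adjoint (c : ℂ) (A : Tor N × Fin d → ℂ) (p : Tor N) :
    (dft N *ᵥ ((GradOp N c)ᴴ *ᵥ A)) p
      = ∑ ν, conj (ssym N c ν p) * (dft N *ᵥ B5Action121.comp N A ν) p := by
  rw [GradOp_conjTranspose_mulVec_eq, divS, Matrix.mulVec_sum, Finset.sum_apply]
  refine Finset.sum_congr rfl fun ν _ => ?_
  rw [Matrix.mulVec_mulVec, dft_mul_sdiffH, ← Matrix.mulVec_mulVec, Matrix.mulVec_diagonal]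
  rfl

end Tools

/-! ## §2 The action of a transported block-diagonal family (the shape of `calDahat`, `calGhat`) -/

section Blocks

variable {d : ℕ} (n : ℕ) [NeZero n] (M : Fin d → ℕ) [hM : ∀ μ, NeZero (M μ)]

/-- a block-diagonal family over the cosets `p = p′ + l`, transported to (fine momentum, component)
indices, acts coset by coset: `(B̂V)(p′ + l, κ) = Σ_{(l′,κ′)} B(p′)_{(l,κ),(l′,κ′)} V(p′ + l′, κ′)`.
[folklore] -/
theorem blockOp_mulVec
    (B : Tor M → Matrix ((Fin d → Fin n) × Fin d) ((Fin d → Fin n) × Fin d) ℂ)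
    (V : Tor (fine n M) × Fin d → ℂ) (i : (Fin d → Fin n) × Fin d) (q : Tor M) :
    ((Matrix.reindex (B5Prop11Plancherel.blockEquiv n M) (B5Prop11Plancherel.blockEquiv n M)).symm
          (Matrix.blockDiagonal B) *ᵥ V) (B5Prop11Plancherel.emb n M (i, q))
      = ∑ j, B q i j * V (B5Prop11Plancherel.emb n M (j, q)) := by
  rw [Matrix.reindex_symm, Matrix.reindex_apply, Equiv.symm_symm]
  simp only [Matrix.mulVec, dotProduct, Matrix.submatrix_apply]
  have h1 : (B5Prop11Plancherel.blockEquiv n M) (B5Prop11Plancherel.emb n M (i, q)) = (i, q) := by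
    rw [← B5Prop11Plancherel.blockEquiv_symm_apply, Equiv.apply_symm_apply]
  rw [h1, Fintype.sum_equiv (B5Prop11Plancherel.blockEquiv n M) _
    (fun J' => Matrix.blockDiagonal B (i, q) J' * V (B5Prop11Plancherel.emb n M J'))
    (fun J => by
      show _ = Matrix.blockDiagonal B (i, q) (B5Prop11Plancherel.blockEquiv n M J)
        * V (B5Prop11Plancherel.emb n M (B5Prop11Plancherel.blockEquiv n M J))
      rw [← B5Prop11Plancherel.blockEquiv_symm_apply, Equiv.symm_apply_apply]),
    Fintype.sum_prod_type]
  simp only [Matrix.blockDiagonal_apply', ite_mul, zero_mul, Finset.sum_ite_eq, Finset.mem_univ,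
    if_true]

end Blocks

/-! ## §3 The position-space operators `Q*_k` and `Δ_a` -/

section PositionSpace

variable {d : ℕ} (n : ℕ) [NeZero n] (M : Fin d → ℕ) [hM : ∀ μ, NeZero (M μ)]

/-- B5's `Q*` = `Q*_k`: the adjoint of the averaging operator `Q_k` (1.18) (`QvOp`, from vector
functions on `T_η` to vector functions on the unit lattice `T₁^{(k)}`) with respect to the scalar
products of the paper — weight `η^d = n^{-d}` on `T_η` (as displayed in (1.21)), unit weight on the
unit lattice — i.e. `η^{-d}` times the conjugate transpose.  The normalisation is the one (and the
only one among scalar multiples of `(Q_k)ᴴ`) for which (1.74) «⟨1, Q*QA_μ⟩ = ⟨1, A_μ⟩» holds: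
`sum_QvAdj_QvOp`.
[cite: Balaban1984PropagatorsI, (1.18) p.20, (1.21) p.21, (1.69) p.29, (1.74) p.30] -/
def QvAdj : Matrix (Tor (fine n M) × Fin d) (Tor M × Fin d) ℂ := ((n : ℂ) ^ d) • (QvOp n M)ᴴ

omit [NeZero n] in
/-- `Q*_k B = η^{-d} (Q_k)ᴴ B`. [folklore] -/
theorem QvAdj_mulVec (B : Tor M × Fin d → ℂ) :
    QvAdj n M *ᵥ B = ((n : ℂ) ^ d) • ((QvOp n M)ᴴ *ᵥ B) := by
  rw [QvAdj, Matrix.smul_mulVec]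

/-- adjointness: `⟨Q_kA, B⟩_{T₁^{(k)}} = ⟨A, Q*_kB⟩_{T_η}`, i.e.
`Σ_b \overline{(Q_kA)(b)} B(b) = η^d Σ_{x,μ} \overline{A_μ(x)} (Q*_kB)_μ(x)`, `η^d = n^{-d}`.
[cite: Balaban1984PropagatorsI, (1.21) p.21, (1.69) p.29] -/
theorem QvAdj_adjoint (A : Tor (fine n M) × Fin d → ℂ) (B : Tor M × Fin d → ℂ) :
    star (QvOp n M *ᵥ A) ⬝ᵥ B = ((n : ℂ) ^ d)⁻¹ * (star A ⬝ᵥ (QvAdj n M *ᵥ B)) := by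
  have hn : ((n : ℂ) ^ d) ≠ 0 := pow_ne_zero _ (by exact_mod_cast NeZero.ne n)
  rw [star_mulVec_dotProduct, QvAdj_mulVec, dotProduct_smul, smul_eq_mul, ← mul_assoc,
    inv_mul_cancel₀ hn, one_mul]

/-- `η^{-d} c_Q² = 1`, `c_Q = 1/√(n^d)` the constant of (1.61) `dft_QvOp`. [folklore] -/
theorem npow_mul_cQ_sq : ((n : ℂ) ^ d) * (cQ n M : ℂ) ^ 2 = 1 := by
  have hn0 : (0 : ℝ) ≤ (n : ℝ) ^ d := by positivity
  have hn : ((n : ℂ) ^ d) ≠ 0 := pow_ne_zero _ (by exact_mod_cast NeZero.ne n)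
  rw [cQ_eq, Complex.ofReal_inv, inv_pow, ← Complex.ofReal_pow, Real.sq_sqrt hn0,
    Complex.ofReal_pow, Complex.ofReal_natCast, mul_inv_cancel₀ hn]

/-- the zero mode of `Q*_kQ_kA` is the zero mode of `A`: `(Q*_kQ_kA)^_μ(0) = Â_μ(0)`.
[cite: Balaban1984PropagatorsI, (1.74) p.30] -/
theorem dft_QvAdj_QvOp_zero (hn : 1 ≤ n) (A : Tor (fine n M) × Fin d → ℂ) (μ : Fin d) :
    (dft (fine n M) *ᵥ B5Action121.comp (fine n M) (QvAdj n M *ᵥ (QvOp n M *ᵥ A)) μ) 0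
      = (dft (fine n M) *ᵥ B5Action121.comp (fine n M) A μ) 0 := by
  have hc : B5Action121.comp (fine n M) (QvAdj n M *ᵥ (QvOp n M *ᵥ A)) μ
      = ((n : ℂ) ^ d) • B5Action121.comp (fine n M) ((QvOp n M)ᴴ *ᵥ (QvOp n M *ᵥ A)) μ := by
    funext x
    simp only [B5Action121.comp, QvAdj_mulVec, Pi.smul_apply]
  have h1 : (dft (fine n M) *ᵥ B5Action121.comp (fine n M) (QvAdj n M *ᵥ (QvOp n M *ᵥ A)) μ)
        (pOf n M (0, 0))
      = (dft (fine n M) *ᵥ B5Action121.comp (fine n M) A μ) (pOf n M (0, 0)) := by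
    rw [hc, Matrix.mulVec_smul, Pi.smul_apply, smul_eq_mul, dft_QvOp_adjoint, sOf_zero,
      uSym_vSym_zero n hn, if_pos rfl, map_one, mul_one, dft_QvOp_zero n M hn, pOf_zero,
      ← mul_assoc, ← mul_assoc, mul_assoc ((n : ℂ) ^ d), ← sq, npow_mul_cQ_sq, one_mul]
  rwa [pOf_zero] at h1

/-- **(1.74) «⟨1, Q*QA_μ⟩ = ⟨1, A_μ⟩» for every component `μ`** («1 denotes here a function on
`T_η` identically equal to 1»; both scalar products carry the same weight `η^d`, so this is
`Σ_x (Q*_kQ_kA)_μ(x) = Σ_x A_μ(x)`): the kernel certificate of the normalisation of `QvAdj`.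
[cite: Balaban1984PropagatorsI, (1.74) p.30] -/
theorem sum_QvAdj_QvOp (hn : 1 ≤ n) (A : Tor (fine n M) × Fin d → ℂ) (μ : Fin d) :
    ∑ x, (QvAdj n M *ᵥ (QvOp n M *ᵥ A)) (x, μ) = ∑ x, A (x, μ) := by
  have hT : (B5Block118.cT (fine n M) : ℂ) ≠ 0 := by
    have h0 : 0 < B5Block118.cT (fine n M) := by
      unfold B5Block118.cT
      exact inv_pos.mpr (Real.sqrt_pos.mpr (by exact_mod_cast Fintype.card_pos))
    exact_mod_cast h0.ne'
  have h1 := dft_QvAdj_QvOp_zero n M hn A μ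
  rw [dft_zero_apply, dft_zero_apply] at h1
  exact mul_left_cancel₀ hT h1

variable (a : ℝ)

/-- **THE OPERATOR `Δ_a` OF (1.69)/(1.73) IN POSITION SPACE**: `Δ_a = Δ − ∂P∂* + aQ*Q` on vector
functions on `T_η` (`η = 1/n`), with `Δ = Σ_ν∇_ν^*∇_ν = ∂*∂ + ∂∂*` componentwise ((1.21), pass 6's
`Lap`), `∂ = GradOp`, `∂* = (GradOp)ᴴ` (= `divS`), `P = PcT = Δ⁻¹Q′*_k(Q′_kΔ⁻²Q′*_k)⁻¹Q′_kΔ⁻¹`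
((1.26)/(1.70)), `Q = Q_k = QvOp` (1.18), `Q* = Q*_k = QvAdj`; so that (1.73) reads `Δ_a A = J`.
[cite: Balaban1984PropagatorsI, (1.69) p.29, (1.70) p.30, (1.73) p.30] -/
def DeltaA : Matrix (Tor (fine n M) × Fin d) (Tor (fine n M) × Fin d) ℂ :=
  Lap n M - GradOp (fine n M) (n : ℂ) * PcT n M (n : ℂ) * (GradOp (fine n M) (n : ℂ))ᴴ
    + (a : ℂ) • (QvAdj n M * QvOp n M)

/-- the left-hand side of (1.73): `Δ_a A = ΔA − ∂(P(∂*A)) + aQ*(QA)`, with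
`Q*_k = η^{-d}(Q_k)ᴴ`. [cite: Balaban1984PropagatorsI, (1.73) p.30] -/
theorem DeltaA_mulVec (A : Tor (fine n M) × Fin d → ℂ) :
    DeltaA n M a *ᵥ A
      = Lap n M *ᵥ A
        - GradOp (fine n M) (n : ℂ) *ᵥ (PcT n M (n : ℂ) *ᵥ ((GradOp (fine n M) (n : ℂ))ᴴ *ᵥ A))
        + ((a : ℂ) * (n : ℂ) ^ d) • ((QvOp n M)ᴴ *ᵥ (QvOp n M *ᵥ A)) := by
  rw [DeltaA, Matrix.add_mulVec, Matrix.sub_mulVec, Matrix.smul_mulVec,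
    ← Matrix.mulVec_mulVec, ← Matrix.mulVec_mulVec, ← Matrix.mulVec_mulVec, QvAdj_mulVec,
    smul_smul]

/-- **(1.69), first form: `Δ_a = ∂*∂ + ∂R∂* + aQ*Q`, `R = I − P`**, with `∂*∂` on vector functions
= `½(CurlOp)ᴴCurlOp` (the `½ Σ_{x,μ,ν}` over ordered pairs of (1.21), pass 7's
`curl_adjoint_curl`: «Δ = ∂*∂ + ∂∂*»). [cite: Balaban1984PropagatorsI, (1.69) p.29, (1.21) p.21] -/
theorem DeltaA_eq_curl :
    DeltaA n M a
      = (1 / 2 : ℂ) • ((CurlOp (fine n M) (n : ℂ))ᴴ * CurlOp (fine n M) (n : ℂ))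
        + GradOp (fine n M) (n : ℂ) * (1 - PcT n M (n : ℂ)) * (GradOp (fine n M) (n : ℂ))ᴴ
        + (a : ℂ) • (QvAdj n M * QvOp n M) := by
  have h := curl_adjoint_curl (fine n M) (n : ℂ)
  have h2 : (1 / 2 : ℂ) • ((CurlOp (fine n M) (n : ℂ))ᴴ * CurlOp (fine n M) (n : ℂ))
      = LapV (fine n M) (n : ℂ) - GradOp (fine n M) (n : ℂ) * (GradOp (fine n M) (n : ℂ))ᴴ := by
    rw [h, smul_smul]
    norm_num
  rw [h2, DeltaA, Lap_eq_LapV, Matrix.mul_sub, Matrix.mul_one, Matrix.sub_mul]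
  abel

end PositionSpace

/-! ## §4 The Fourier blocks of `Δ_a` are the fibers `Da` / `Da₀` of pass 5 -/

section Fibers

variable {d : ℕ} (n : ℕ) [NeZero n] (hn : 1 ≤ n) (M : Fin d → ℕ) [hM : ∀ μ, NeZero (M μ)]
  (a : ℝ) (ha : 0 < a)

/-- the block of `𝒟̂_a` at `p′ ≠ 0` is `Da` of the fiber at `p′`. [folklore] -/
theorem DaBlocks_of_ne {q : Tor M} (hq : q ≠ 0) :
    DaBlocks n hn M a ha q = Da (fiberAt n M hn a ha q hq) := by
  rw [DaBlocks, dif_neg hq]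
  rfl

/-- the block of `𝒟̂_a` at `p′ = 0` is `Da₀`. [folklore] -/
theorem DaBlocks_zero :
    DaBlocks n hn M a ha 0
      = Da₀ (d := d) (0 : Fin d → Fin n) a (fun k => DeltaXir n 0 (shiftr n k 0)) := by
  rw [DaBlocks, dif_pos rfl]
  rfl

/-- `e_μ(l)` of the fiber at `q` is the symbol `∂_μ(p′ + l)` (`dSym`). [folklore] -/
theorem fiberAt_e {q : Tor M} (hq : q ≠ 0) (μ : Fin d) (k : Fin d → Fin n) :
    (fiberAt n M hn a ha q hq).e μ k = dSym n k (sOf M q) μ := rfl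

/-- the `a` of the fiber is `a`. [folklore] -/
theorem fiberAt_a {q : Tor M} (hq : q ≠ 0) : (fiberAt n M hn a ha q hq).a = a := rfl

/-- entries of pass 5's `∂P∂*` block:
`(dOp·Pproj·dOpᴴ)_{(l,κ),(l′,ν)} = e_κ(l) P_{l l′} \overline{e_ν(l′)}`. [folklore] -/
theorem dPd_apply {Λ : Type*} [Fintype Λ] [DecidableEq Λ] (F : Fiber Λ d) (i j : Λ × Fin d) :
    (dOp F * B5Prop11Inverse.Pproj F * (dOp F)ᴴ) i j
      = F.e i.2 i.1 * B5Prop11Inverse.Pproj F i.1 j.1 * conj (F.e j.2 j.1) := by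
  have hD : ∀ i' l, dOp F i' l = if i'.1 = l then F.e i'.2 l else 0 := fun _ _ => rfl
  have hH : ∀ l, (dOp F)ᴴ l j = if j.1 = l then conj (F.e j.2 l) else 0 := by
    intro l
    rw [Matrix.conjTranspose_apply, hD]
    split_ifs
    · rfl
    · exact star_zero ℂ
  simp only [Matrix.mul_apply, hH, hD, ite_mul, zero_mul, mul_ite, mul_zero, Finset.sum_ite_eq,
    Finset.mem_univ, if_true]

/-- `p′ ≠ 0`, the `Δ` term: `(ΔA)^_κ(p′+l) = Σ_j (lapV F)_{(l,κ),j} Â_j`. [folklore] -/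
theorem fiber_Lap_term (A : Tor (fine n M) × Fin d → ℂ) (k : Fin d → Fin n) {q : Tor M}
    (hq : q ≠ 0) (κ : Fin d) :
    (dftV (fine n M) *ᵥ (Lap n M *ᵥ A)) (pOf n M (k, q), κ)
      = (lapV (fiberAt n M hn a ha q hq) *ᵥ
          fun j => (dftV (fine n M) *ᵥ A) (pOf n M (j.1, q), j.2)) (k, κ) := by
  rw [dft_Lap_fiber n M hn a ha A k hq κ, lapV, Matrix.mulVec_diagonal]

/-- `p′ ≠ 0`, the `∂P∂*` term: `(∂P∂*A)^_κ(p′+l) = Σ_j (dOp·Pproj·dOpᴴ)_{(l,κ),j} Â_j` — the symbols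
(1.31) of `∂`, `∂*` and `B5Momentum133.fiber_PcT` (the fiber of `P` is `Pproj`).
[cite: Balaban1984PropagatorsI, (1.70) p.30, (1.73) p.30, (1.83) p.31] -/
theorem fiber_dPd_term (A : Tor (fine n M) × Fin d → ℂ) (k : Fin d → Fin n) {q : Tor M}
    (hq : q ≠ 0) (κ : Fin d) :
    (dftV (fine n M) *ᵥ (GradOp (fine n M) (n : ℂ) *ᵥ (PcT n M (n : ℂ) *ᵥ
        ((GradOp (fine n M) (n : ℂ))ᴴ *ᵥ A)))) (pOf n M (k, q), κ)
      = ((dOp (fiberAt n M hn a ha q hq) * B5Prop11Inverse.Pproj (fiberAt n M hn a ha q hq)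
            * (dOp (fiberAt n M hn a ha q hq))ᴴ) *ᵥ
          fun j => (dftV (fine n M) *ᵥ A) (pOf n M (j.1, q), j.2)) (k, κ) := by
  rw [dftV_mulVec_apply, dft_comp_GradOp, ssym_pOf, fiber_PcT n M hn a ha _ k hq]
  simp only [dft_GradOp_adjoint, ssym_pOf, dftV_mulVec_apply]
  simp only [Matrix.mulVec, dotProduct, dPd_apply, fiberAt_e, Fintype.sum_prod_type,
    Finset.mul_sum]
  refine Finset.sum_congr rfl fun k' _ => Finset.sum_congr rfl fun ν _ =>
    Finset.sum_congr rfl fun x _ => ?_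
  ring

/-- `p′ ≠ 0`, the `aQ*Q` term: `η^{-d}((Q_k)ᴴQ_kA)^_κ(p′+l) = Σ_j ((Qv F)ᴴQv F)_{(l,κ),j} Â_j`
(`B5FiberQQ.fiber_QstarQ`, `η^{-d}c_Q² = 1`). [cite: Balaban1984PropagatorsI, (1.83)-(1.84) p.31] -/
theorem fiber_QQ_term (A : Tor (fine n M) × Fin d → ℂ) (k : Fin d → Fin n) {q : Tor M}
    (hq : q ≠ 0) (κ : Fin d) :
    ((n : ℂ) ^ d) * (dftV (fine n M) *ᵥ ((QvOp n M)ᴴ *ᵥ (QvOp n M *ᵥ A))) (pOf n M (k, q), κ)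
      = (((B5Prop11Inverse.Qv (fiberAt n M hn a ha q hq))ᴴ
            * B5Prop11Inverse.Qv (fiberAt n M hn a ha q hq)) *ᵥ
          fun j => (dftV (fine n M) *ᵥ A) (pOf n M (j.1, q), j.2)) (k, κ) := by
  rw [dftV_mulVec_apply, fiber_QstarQ n M hn a ha A k hq κ, ← mul_assoc, npow_mul_cQ_sq, one_mul]
  simp only [dftV_mulVec_apply]
  rfl

/-- **the fiber of `Δ_a` at `p′ ≠ 0` is pass 5's `Da (fiberAt p′)`**:
`(Δ_a A)^(p′+l, κ) = Σ_j Da(p′)_{(l,κ),j} Â(p′+l_j, κ_j)`.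
[cite: Balaban1984PropagatorsI, (1.73) p.30, (1.83) p.31] -/
theorem fiber_DeltaA_of_ne (A : Tor (fine n M) × Fin d → ℂ) (k : Fin d → Fin n) {q : Tor M}
    (hq : q ≠ 0) (κ : Fin d) :
    (dftV (fine n M) *ᵥ (DeltaA n M a *ᵥ A)) (pOf n M (k, q), κ)
      = (DaBlocks n hn M a ha q *ᵥ
          fun j => (dftV (fine n M) *ᵥ A) (pOf n M (j.1, q), j.2)) (k, κ) := by
  rw [DaBlocks_of_ne n hn M a ha hq, DeltaA_mulVec, Matrix.mulVec_add, Matrix.mulVec_sub,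
    Matrix.mulVec_smul, Pi.add_apply, Pi.sub_apply, Pi.smul_apply, smul_eq_mul, Da,
    Matrix.add_mulVec, Matrix.sub_mulVec, Matrix.smul_mulVec, Pi.add_apply, Pi.sub_apply,
    Pi.smul_apply, smul_eq_mul, fiber_Lap_term n hn M a ha A k hq κ,
    fiber_dPd_term n hn M a ha A k hq κ, fiberAt_a, mul_assoc, fiber_QQ_term n hn M a ha A k hq κ]

/-- `p′ = 0`, the `Δ` term: `(ΔA)^_κ(l) = Δ(l) Â_κ(l)`, `Δ(l) = DeltaXir n 0 (shiftr n l 0)`.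
[folklore] -/
theorem fiber_Lap_term_zero (A : Tor (fine n M) × Fin d → ℂ) (k : Fin d → Fin n) (κ : Fin d) :
    (dftV (fine n M) *ᵥ (Lap n M *ᵥ A)) (pOf n M (k, 0), κ)
      = (Matrix.diagonal
            (fun i : (Fin d → Fin n) × Fin d => ((DeltaXir n 0 (shiftr n i.1 0) : ℝ) : ℂ))
          *ᵥ fun j => (dftV (fine n M) *ᵥ A) (pOf n M (j.1, 0), j.2)) (k, κ) := by
  rw [dft_Lap, sOf_zero, Matrix.mulVec_diagonal]
  simp only [Delta_eq]

/-- `p′ = 0`, the `∂P∂*` term vanishes: `Δ⁻¹` is `0` on constants and `(Q′*_kY)~(l) = 0` for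
`l ≠ 0` (`B5Momentum133.dft_PcT_zero_fiber`). [cite: Balaban1984PropagatorsI, p.22, p.23] -/
theorem fiber_dPd_term_zero (A : Tor (fine n M) × Fin d → ℂ) (k : Fin d → Fin n) (κ : Fin d) :
    (dftV (fine n M) *ᵥ (GradOp (fine n M) (n : ℂ) *ᵥ (PcT n M (n : ℂ) *ᵥ
        ((GradOp (fine n M) (n : ℂ))ᴴ *ᵥ A)))) (pOf n M (k, 0), κ) = 0 := by
  rw [dftV_mulVec_apply, dft_comp_GradOp, dft_PcT_zero_fiber, mul_zero]

include hn in
/-- `p′ = 0`, the `aQ*Q` term: `η^{-d}((Q_k)ᴴQ_kA)^_κ(l) = Σ_j ((Qv₀ 0)ᴴQv₀ 0)_{(l,κ),j} Â_j`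
(`B5FiberZero.dft_QstarQ_zero_fiber`). [cite: Balaban1984PropagatorsI, (1.74) p.30, (1.83) p.31] -/
theorem fiber_QQ_term_zero (A : Tor (fine n M) × Fin d → ℂ) (k : Fin d → Fin n) (κ : Fin d) :
    ((n : ℂ) ^ d) * (dftV (fine n M) *ᵥ ((QvOp n M)ᴴ *ᵥ (QvOp n M *ᵥ A))) (pOf n M (k, 0), κ)
      = (((Qv₀ (d := d) (0 : Fin d → Fin n))ᴴ * Qv₀ (d := d) (0 : Fin d → Fin n)) *ᵥ
          fun j => (dftV (fine n M) *ᵥ A) (pOf n M (j.1, 0), j.2)) (k, κ) := by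
  rw [dftV_mulVec_apply, dft_QstarQ_zero_fiber n M hn A k κ, ← mul_assoc, npow_mul_cQ_sq,
    one_mul]
  simp only [dftV_mulVec_apply]
  rfl

include hn in
/-- **the fiber of `Δ_a` at `p′ = 0` is pass 5's `Da₀`**. [cite: Balaban1984PropagatorsI,
(1.73)-(1.74) p.30] -/
theorem fiber_DeltaA_zero (A : Tor (fine n M) × Fin d → ℂ) (k : Fin d → Fin n) (κ : Fin d) :
    (dftV (fine n M) *ᵥ (DeltaA n M a *ᵥ A)) (pOf n M (k, 0), κ)
      = (DaBlocks n hn M a ha 0 *ᵥ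
          fun j => (dftV (fine n M) *ᵥ A) (pOf n M (j.1, 0), j.2)) (k, κ) := by
  rw [DaBlocks_zero n hn M a ha, DeltaA_mulVec, Matrix.mulVec_add, Matrix.mulVec_sub,
    Matrix.mulVec_smul, Pi.add_apply, Pi.sub_apply, Pi.smul_apply, smul_eq_mul, Da₀,
    Matrix.add_mulVec, Matrix.smul_mulVec, Pi.add_apply, Pi.smul_apply, smul_eq_mul,
    fiber_Lap_term_zero n M A k κ, fiber_dPd_term_zero n M A k κ, sub_zero, mul_assoc,
    fiber_QQ_term_zero n hn M A k κ]

/-- the fiber decomposition of `Δ_a`, all cosets. [cite: Balaban1984PropagatorsI, (1.73) p.30] -/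
theorem fiber_DeltaA (A : Tor (fine n M) × Fin d → ℂ) (k : Fin d → Fin n) (q : Tor M) (κ : Fin d) :
    (dftV (fine n M) *ᵥ (DeltaA n M a *ᵥ A)) (pOf n M (k, q), κ)
      = (DaBlocks n hn M a ha q *ᵥ
          fun j => (dftV (fine n M) *ᵥ A) (pOf n M (j.1, q), j.2)) (k, κ) := by
  by_cases hq : q = 0
  · subst hq
    exact fiber_DeltaA_zero n hn M a ha A k κ
  · exact fiber_DeltaA_of_ne n hn M a ha A k hq κ

/-- `U Δ_a A = 𝒟̂_a U A` for every vector function `A`. [folklore] -/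
theorem dftV_DeltaA_mulVec (A : Tor (fine n M) × Fin d → ℂ) :
    dftV (fine n M) *ᵥ (DeltaA n M a *ᵥ A) = calDahat n hn M a ha *ᵥ (dftV (fine n M) *ᵥ A) := by
  funext I
  obtain ⟨J, rfl⟩ := (B5Prop11Plancherel.blockEquiv n M).symm.surjective I
  obtain ⟨⟨k, κ⟩, q⟩ := J
  rw [B5Prop11Plancherel.blockEquiv_symm_apply, calDahat, blockOp_mulVec, emb_eq,
    fiber_DeltaA n hn M a ha]
  simp only [Matrix.mulVec, dotProduct]
  refine Finset.sum_congr rfl fun j _ => ?_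
  rfl

/-- `U Δ_a = 𝒟̂_a U`. [folklore] -/
theorem dftV_mul_DeltaA :
    dftV (fine n M) * DeltaA n M a = calDahat n hn M a ha * dftV (fine n M) :=
  ext_of_mulVec fun A => by
    rw [← Matrix.mulVec_mulVec, ← Matrix.mulVec_mulVec, dftV_DeltaA_mulVec n hn M a ha]

/-- **MAIN THEOREM. The operator `𝒟_a = U^*𝒟̂_aU` of passes 4–6 (Fourier blocks = the fibers of
(1.73)) IS the position-space operator `Δ_a = Δ − ∂P∂* + aQ*Q` of (1.69)/(1.73).**
[cite: Balaban1984PropagatorsI, (1.69) p.29, (1.73) p.30, (1.83) p.31 (proof ours)] -/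
theorem calDa_eq_DeltaA : calDa n hn M a ha = DeltaA n M a := by
  rw [calDa, Matrix.mul_assoc, ← dftV_mul_DeltaA n hn M a ha, ← Matrix.mul_assoc, star_dftV_mul,
    Matrix.one_mul]

end Fibers

/-! ## §5 Consequences for the position-space `Δ_a`: (1.71), (1.73), positivity, (1.89), (1.90) -/

section Consequences

variable {d : ℕ} (n : ℕ) [NeZero n] (hn : 1 ≤ n) (M : Fin d → ℕ) [hM : ∀ μ, NeZero (M μ)]
  (a : ℝ) (ha : 0 < a)

include hn ha

/-- `Δ_a 𝒢 = 1`, `𝒢` the operator with Fourier blocks (1.83). [cite: Balaban1984PropagatorsI,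
(1.71) p.30, (1.83) p.31 (proof ours)] -/
theorem DeltaA_mul_calG : DeltaA n M a * calG n hn M a ha = 1 := by
  rw [← calDa_eq_DeltaA n hn M a ha]
  exact calDa_mul_calG n hn M a ha

/-- `𝒢 Δ_a = 1`. [cite: Balaban1984PropagatorsI, (1.71) p.30 (proof ours)] -/
theorem calG_mul_DeltaA : calG n hn M a ha * DeltaA n M a = 1 := by
  rw [← calDa_eq_DeltaA n hn M a ha]
  exact calG_mul_calDa n hn M a ha

/-- **(1.71) «Δ_a⁻¹ = G_k, or simply G»** for the position-space `Δ_a`: the inverse of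
`Δ − ∂P∂* + aQ*Q` is the operator `𝒢` whose Fourier blocks over the cosets `p = p′ + l` are the
matrices (1.83) (`B5Prop11Plancherel.calG`).
[cite: Balaban1984PropagatorsI, (1.71) p.30, (1.83) p.31 (proof ours)] -/
theorem calG_eq_DeltaA_inv : calG n hn M a ha = (DeltaA n M a)⁻¹ :=
  (Matrix.inv_eq_right_inv (DeltaA_mul_calG n hn M a ha)).symm

/-- `Δ_a` is invertible. [cite: Balaban1984PropagatorsI, p.30 («It is an invertible operator»;
proof ours)] -/
theorem isUnit_DeltaA : IsUnit (DeltaA n M a) :=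
  ⟨⟨DeltaA n M a, calG n hn M a ha, DeltaA_mul_calG n hn M a ha, calG_mul_DeltaA n hn M a ha⟩, rfl⟩

/-- «Of course it is a symmetric operator»: `Δ_a` is Hermitian. [cite: Balaban1984PropagatorsI,
p.30 (proof ours)] -/
theorem DeltaA_isHermitian : (DeltaA n M a).IsHermitian := by
  rw [← calDa_eq_DeltaA n hn M a ha]
  exact calDa_isHermitian n hn M a ha

/-- «it is non-negative»: `Δ_a` is positive semidefinite (pass 6's `calDa_posSemidef`).
[cite: Balaban1984PropagatorsI, p.30 (proof ours, via (1.83))] -/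
theorem DeltaA_posSemidef : (DeltaA n M a).PosSemidef := by
  rw [← calDa_eq_DeltaA n hn M a ha]
  exact calDa_posSemidef n hn M a ha

/-- **«Δ_a is a positive operator»**: positive definite. [cite: Balaban1984PropagatorsI, p.30
(proof ours: non-negative and invertible)] -/
theorem DeltaA_posDef : (DeltaA n M a).PosDef :=
  (DeltaA_posSemidef n hn M a ha).posDef_iff_isUnit.mpr (isUnit_DeltaA n hn M a ha)

/-- **(1.73) «has a unique solution for the arbitrary vector function J»**: for every `J` there is
exactly one vector function `A` on `T_η` with `ΔA − ∂Δ⁻¹Q′*(Q′Δ⁻²Q′*)⁻¹Q′Δ⁻¹∂*A + aQ*QA = J`.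
[cite: Balaban1984PropagatorsI, (1.73) p.30 (proof ours)] -/
theorem existsUnique_solution (J : Tor (fine n M) × Fin d → ℂ) :
    ∃! A : Tor (fine n M) × Fin d → ℂ, DeltaA n M a *ᵥ A = J := by
  refine ⟨calG n hn M a ha *ᵥ J, ?_, fun A (hA : DeltaA n M a *ᵥ A = J) => ?_⟩
  · show DeltaA n M a *ᵥ (calG n hn M a ha *ᵥ J) = J
    rw [Matrix.mulVec_mulVec, DeltaA_mul_calG n hn M a ha, Matrix.one_mulVec]
  · rw [← hA, Matrix.mulVec_mulVec, calG_mul_DeltaA n hn M a ha, Matrix.one_mulVec]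

/-- … and the solution is `A = GJ`. [cite: Balaban1984PropagatorsI, (1.71) p.30, (1.73) p.30
(proof ours)] -/
theorem solution_eq {J A : Tor (fine n M) × Fin d → ℂ} (hA : DeltaA n M a *ᵥ A = J) :
    A = calG n hn M a ha *ᵥ J := by
  rw [← hA, Matrix.mulVec_mulVec, calG_mul_DeltaA n hn M a ha, Matrix.one_mulVec]

open scoped MatrixOrder in
/-- **(1.90) for the position-space `Δ_a`**: `γ(Δ + I) ≤ Δ_a` in the Löwner order,
`γ = 1/((d+1)·Cst(d,a))` (kernel version of pass 6, constant ours).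
[cite: Balaban1984PropagatorsI, Prop. 1.1 (1.90) p.33 (kernel version; constant and proof ours)] -/
theorem smul_LapOne_le_DeltaA :
    (((1 / ((d + 1 : ℝ) * Cst d a)) : ℝ) : ℂ) • (Lap n M + 1) ≤ DeltaA n M a := by
  rw [← calDa_eq_DeltaA n hn M a ha]
  exact smul_LapOne_le_calDa n hn M a ha

/-- **(1.89), first bound, for `G = Δ_a⁻¹` with the position-space `Δ_a`**: `‖Δ_a⁻¹‖ ≤ Cst(d,a)`
uniformly in `η` and `T_η`. [cite: Balaban1984PropagatorsI, Prop. 1.1 (1.89) p.33 (kernel version;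
proof ours)] -/
theorem opNorm_DeltaA_inv_le : ‖(DeltaA n M a)⁻¹‖ ≤ Cst d a := by
  rw [← calG_eq_DeltaA_inv n hn M a ha]
  exact opNorm_calG_le n hn M a ha

/-- (1.89), second bound: `‖∇_ν Δ_a⁻¹‖ ≤ Cst(d,a)`. [cite: Balaban1984PropagatorsI, Prop. 1.1 (1.89)
p.33 (kernel version; proof ours)] -/
theorem opNorm_fdiff_DeltaA_inv_le (ν : Fin d) :
    ‖fdiff (fine n M) (n : ℂ) ν * (DeltaA n M a)⁻¹‖ ≤ Cst d a := by
  rw [← calG_eq_DeltaA_inv n hn M a ha]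
  exact opNorm_fdiff_calG_le n hn M a ha ν

/-- (1.89), third bound: `‖Δ_a⁻¹ ∇_ν^*‖ ≤ Cst(d,a)`.
[cite: Balaban1984PropagatorsI, Prop. 1.1 (1.89) p.33 (kernel version; proof ours)] -/
theorem opNorm_DeltaA_inv_star_fdiff_le (ν : Fin d) :
    ‖(DeltaA n M a)⁻¹ * star (fdiff (fine n M) (n : ℂ) ν)‖ ≤ Cst d a := by
  rw [← calG_eq_DeltaA_inv n hn M a ha]
  exact opNorm_calG_star_fdiff_le n hn M a ha ν

/-- (1.89), fourth bound: `‖∇_ν Δ_a⁻¹ ∇_{ν′}^*‖ ≤ Cst(d,a)`. [cite: Balaban1984PropagatorsI,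
Prop. 1.1 (1.89) p.33 (kernel version; proof ours)] -/
theorem opNorm_fdiff_DeltaA_inv_star_fdiff_le (ν ν' : Fin d) :
    ‖fdiff (fine n M) (n : ℂ) ν * (DeltaA n M a)⁻¹ * star (fdiff (fine n M) (n : ℂ) ν')‖
      ≤ Cst d a := by
  rw [← calG_eq_DeltaA_inv n hn M a ha]
  exact opNorm_fdiff_calG_star_fdiff_le n hn M a ha ν ν'

end Consequences

end

end Literature.MathematicalPhysics.QuantumFieldTheory.Balaban1983to89.B5DeltaA169
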